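import Literature.AlgebraicGeometry.GroupSchemes.IdealTorsionCoprimeSplittingRank
import Literature.AlgebraicGeometry.GroupSchemes.TorsionLayerBlockIdempotents
import HarnessLib

/-!
# The rank of ANY realisation of the `𝔞𝔟`-torsion: `rk Γ(X[𝔞𝔟]) = rk Γ(X[𝔞]) · rk Γ(X[𝔟])` for coprime `𝔞`, `𝔟`
# ([Tate1997FiniteFlatGroupSchemes] (1.6)–(1.7), §(3.7); [Tate1967] §2.2; [Neukirch1999] Ch. I §3 (3.6))

Topic `Literature/AlgebraicGeometry/GroupSchemes`; namespace `Literature.AlgebraicGeometry.GroupSchemes.IdealTorsionCoprimeSplitting` (continues ★ p849988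
`IdealTorsionCoprimeSplittingRank` and ★ `KernelCoprimeTorsionRank`).  THEOREMS ONLY (no definition, no named fact, no instance, no notation, no `sorry`).
Cell `hodgecm-mathlib` (D-0151), P6 «MOD programme» (crux hLiu418 = stmt-HodgeConjecture-24832, `--supports`, count-neutral), half-A line L2 (LS leaflet
`Lines/F0_P6a_LineSpecialisation.lean` §3 [WQ], (C6′) fold `comp_eq_one_iff_of_two_quotLegs` of LA2-p04 (g2), binder **(RKG) `hrkG`** «the rank of
`A_x̄[𝔭_w𝔭_{c•w}]` BY VALUE for every closed realisation»; LA2-plan (g2) deal 2026-09-02T08:19Z to A-p06 (g36)).  HONEST LABEL: HC_CM is proved only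
modulo the 2 remaining named inputs (hLiu418 24832, h413 24833) until rung 0 closes; this file is generic and discharges none of them.

THE MATHEMATICS.  `k` a field, `X` a `k`-group scheme with an action `ι : O → End X` of a commutative ring by homomorphisms (`ι 1 = 𝟙`, `ι(a+b) = ι a · ι b`,
`ι(ab) = ι b ≫ ι a` — ★ `RingAction` conventions), `𝔞 + 𝔟 = (1)`.  A REALISATION of `X[𝔠]` is a monomorphism `j : G ↪ X` whose `T`-points are exactly the
points of `X` killed by `ι(𝔠)` ([Tate1997FiniteFlatGroupSchemes] (1.6)–(1.7): subgroups by their `T`-points).  (§1) On any realisation `j : G ↪ X` of `X[𝔠]` by a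
monomorphic homomorphism the action RESTRICTS: `β : O → End G`, homomorphisms with `β a ≫ j = j ≫ ι a` (the point `j ≫ ι b` is again `𝔠`-torsion since
`ι b ≫ ι c = ι(cb)`, `cb ∈ 𝔠`), unital ∕ additive ∕ anti-multiplicative (★ `TorsionLayer.layerEnd_*`), and `β c = 1` for `c ∈ 𝔠`.  (§2) A realisation
`ιa : Ga ↪ X` of `X[𝔞]` with `𝔠 ⊆ 𝔞` LIFTS through `j` to a monomorphism `Ga ↪ G` whose `T`-points are the points of `G` killed by `β(𝔞)` — a realisation of
`G[𝔞]` relative to `β`.  (§3) HEAD: for realisations `Ga ↪ X` of `X[𝔞]`, `Gb ↪ X` of `X[𝔟]` and ANY realisation `G ↪ X` of `X[𝔞𝔟]` with `G` affine and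
`Γ(G)` finite over `k`: **`rk Γ(G) = rk Γ(Ga) · rk Γ(Gb)`** — ★ p849988 `finrank_alg_eq_mul_of_sup_eq_top` ([Tate1997FiniteFlatGroupSchemes] §(3.7): the coprime
(CRT) splitting `G ≅ G[𝔞] × G[𝔟]`, ranks multiply; [Tate1967] §2.2; [Neukirch1999] I (3.6)) applied to `G` with the lifted sub-realisations.  (§4) The dress for an
abelian scheme `A → Spec k` with a ★ `RingAction` (the L2 consumer reads it at `A := A_x̄`, `𝔞 := 𝔭_w`, `𝔟 := 𝔭_{c•w}`, `Ga := ★ p849994's layer`, `Gb := the dock's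
`G₀`).

* §1 `exists_layerEnd_of_idealTorsion`, `layerEnd_eq_one_of_mem`;
* §2 `exists_lift_of_idealTorsion_of_le`, `exists_comp_lift_eq_iff`;
* §3 HEAD **`finrank_alg_eq_mul_of_idealTorsion_realisations`**;
* §4 **`finrank_alg_eq_mul_of_idealTorsion_realisations_ringAction`**.

## References
* [Tate1997FiniteFlatGroupSchemes] J. Tate, *Finite flat group schemes*, in: Modular Forms and Fermat's Last Theorem (1997) — (1.6)–(1.7) (p. 122), §(3.7) (p. 146).
* [Tate1967] J. T. Tate, *p-divisible groups* (1967) — §2.2.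
* [Neukirch1999] J. Neukirch, *Algebraic Number Theory* (1999) — Ch. I §3 (3.6).
* [GortzWedhorn2020] U. Görtz, T. Wedhorn, *Algebraic Geometry I*, 2nd ed. (2020) — Definition 4.45 (2) (p. 117).
-/

set_option autoImplicit false

-- Mathlib's `Over`/`Scheme` APIs are stated across semireducible wrappers (as in the ★ `GroupSchemes/*` files).
set_option backward.isDefEq.respectTransparency false

noncomputable section

universe u v

open CategoryTheory CategoryTheory.Limits AlgebraicGeometry MonoidalCategory CartesianMonoidalCategory
open scoped MonObj

namespace Literature.AlgebraicGeometry.GroupSchemes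

namespace IdealTorsionCoprimeSplitting

open Literature.AlgebraicGeometry.Motives GroupSchemeKernel AffineGroupScheme TorsionLayer

variable {k : Type u} [Field k] {O : Type v} [CommRing O]
variable {X : SchemeOver k} [GrpObj X] (act : O → (X ⟶ X)) [∀ a, IsMonHom (act a)]

/-! ## §1 The restricted action on a realisation of `X[𝔠]` -/

section Layer

variable {𝔠 : Ideal O} {G : SchemeOver k} [GrpObj G] (j : G ⟶ X) [IsMonHom j] [Mono j]
  (hG : ∀ ⦃T : SchemeOver k⦄ (t : T ⟶ X), (∃ s : T ⟶ G, s ≫ j = t) ↔ ∀ c ∈ 𝔠, t ≫ act c = 1)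

include hG in
/-- **THE ACTION RESTRICTS TO ANY REALISATION OF `X[𝔠]`**: for a monomorphic homomorphism `j : G ↪ X` reading «`t ∈ G ↔ ι(𝔠) t = 1`» and an anti-multiplicative
family of homomorphisms `ι : O → End X`, there is `β : O → End G`, homomorphisms, with `β a ≫ j = j ≫ ι a` (the point `j ≫ ι b` is `𝔠`-torsion: `ι b ≫ ι c = ι(c b)`,
`c b ∈ 𝔠`). [cite: Tate1967, §2.2] [cite: Tate1997FiniteFlatGroupSchemes, (1.6)–(1.7) p. 122] -/
theorem exists_layerEnd_of_idealTorsion (hmul : ∀ a b, act (a * b) = act b ≫ act a) :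
    ∃ β : O → (G ⟶ G), (∀ a, IsMonHom (β a)) ∧ ∀ a, β a ≫ j = j ≫ act a := by
  have hj : ∀ c ∈ 𝔠, j ≫ act c = 1 := (hG j).1 ⟨𝟙 G, Category.id_comp j⟩
  have h : ∀ b, ∃ β : G ⟶ G, β ≫ j = j ≫ act b := fun b =>
    (hG (j ≫ act b)).2 fun c hc => by rw [Category.assoc, ← hmul, hj _ (Ideal.mul_mem_right b 𝔠 hc)]
  choose β hβ using h
  exact ⟨β, fun a => isMonHom_layerEnd j (hβ a), hβ⟩

omit [∀ a, IsMonHom (act a)] in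
include hG in
/-- **`𝔠` KILLS THE LAYER**: `β c = 1` for `c ∈ 𝔠` (the tautological point `j` is `𝔠`-torsion; cancel the monomorphism `j`). [cite: Tate1997FiniteFlatGroupSchemes, §(3.7) (p. 146)] -/
theorem layerEnd_eq_one_of_mem (β : O → (G ⟶ G)) (hβ : ∀ a, β a ≫ j = j ≫ act a) (c : O) (hc : c ∈ 𝔠) : β c = 1 := by
  rw [← cancel_mono j, hβ, MonObj.one_comp]
  exact (hG j).1 ⟨𝟙 G, Category.id_comp j⟩ c hc

/-! ## §2 Sub-realisations lift into the layer -/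

variable {𝔞 : Ideal O} {Ga : SchemeOver k} (ιa : Ga ⟶ X)
  (hGa : ∀ ⦃T : SchemeOver k⦄ (t : T ⟶ X), (∃ s : T ⟶ Ga, s ≫ ιa = t) ↔ ∀ a ∈ 𝔞, t ≫ act a = 1)

omit [∀ a, IsMonHom (act a)] [GrpObj G] [IsMonHom j] [Mono j] in
include hG hGa in
/-- **A realisation of `X[𝔞]`, `𝔠 ⊆ 𝔞`, LIFTS THROUGH a realisation of `X[𝔠]`**: `∃ l : Ga ⟶ G, l ≫ j = ιa` (the tautological point `ιa` is `𝔞`-torsion, hence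
`𝔠`-torsion). [cite: Tate1997FiniteFlatGroupSchemes, (1.6)–(1.7) p. 122] [cite: GortzWedhorn2020, Definition 4.45 (2) (p. 117)] -/
theorem exists_lift_of_idealTorsion_of_le (h𝔠𝔞 : 𝔠 ≤ 𝔞) : ∃ l : Ga ⟶ G, l ≫ j = ιa :=
  (hG ιa).2 fun c hc => (hGa ιa).1 ⟨𝟙 Ga, Category.id_comp ιa⟩ c (h𝔠𝔞 hc)

omit [∀ a, IsMonHom (act a)] in
include hGa in
/-- **THE LIFT READS THE `𝔞`-TORSION OF THE LAYER**: for `l ≫ j = ιa` and the restricted action `β` (`β a ≫ j = j ≫ ι a`), a `T`-point `x` of `G` factors through `l`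
iff `x ≫ β a = 1` for all `a ∈ 𝔞` — the points law of ★ p849988's `K[𝔞] ↪ K`, relative to `β`. [cite: Tate1997FiniteFlatGroupSchemes, (1.6)–(1.7) p. 122]
[cite: GortzWedhorn2020, Definition 4.45 (2) (p. 117)] -/
theorem exists_comp_lift_eq_iff (β : O → (G ⟶ G)) (hβ : ∀ a, β a ≫ j = j ≫ act a) {l : Ga ⟶ G} (hl : l ≫ j = ιa)
    ⦃T : SchemeOver k⦄ (x : T ⟶ G) : (∃ s : T ⟶ Ga, s ≫ l = x) ↔ ∀ a ∈ 𝔞, x ≫ β a = 1 := by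
  constructor
  · rintro ⟨s, rfl⟩ a ha
    rw [← cancel_mono j, Category.assoc, Category.assoc, hβ, reassoc_of% hl, MonObj.one_comp, ← Category.assoc]
    exact (hGa (s ≫ ιa)).1 ⟨s, rfl⟩ a ha
  · intro hx
    obtain ⟨s, hs⟩ := (hGa (x ≫ j)).2 fun a ha => by
      rw [Category.assoc, ← hβ, ← Category.assoc, hx a ha, MonObj.one_comp]
    exact ⟨s, by rw [← cancel_mono j, Category.assoc, hl, hs]⟩

end Layer

/-! ## §3 The head: the rank of any realisation of `X[𝔞𝔟]` -/

/-- **THE RANK OF ANY REALISATION OF THE `𝔞𝔟`-TORSION, `𝔞 + 𝔟 = (1)`.**  `X` a `k`-group scheme with `ι : O → End X` by homomorphisms (unital, additive,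
anti-multiplicative); `ιa : Ga ↪ X` a realisation of `X[𝔞]` by a monomorphic homomorphism with `Ga` affine, `ιb : Gb ↪ X` a realisation of `X[𝔟]` by a monomorphism;
then EVERY realisation `j : G ↪ X` of `X[𝔞𝔟]` by a monomorphic homomorphism with `G` affine and `Γ(G)` finite over `k` has
**`dim_k Γ(G) = dim_k Γ(Ga) · dim_k Γ(Gb)`**.  PROOF: restrict `ι` to `G` (§1), lift `ιa`, `ιb` into `G` (§2; `𝔞𝔟 ⊆ 𝔞`, `𝔞𝔟 ⊆ 𝔟`) — they read `G[𝔞]`, `G[𝔟]` relative to the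
restricted action — and apply ★ p849988 `finrank_alg_eq_mul_of_sup_eq_top` (`G ≅ G[𝔞] × G[𝔟]`). [cite: Tate1997FiniteFlatGroupSchemes, §(3.7) (p. 146)]
[cite: Tate1967, §2.2] [cite: Neukirch1999, Ch. I §3 (3.6)] -/
theorem finrank_alg_eq_mul_of_idealTorsion_realisations
    (hone : act 1 = 𝟙 X) (hadd : ∀ a b, act (a + b) = act a * act b) (hmul : ∀ a b, act (a * b) = act b ≫ act a)
    {𝔞 𝔟 : Ideal O} (h𝔞𝔟 : 𝔞 ⊔ 𝔟 = ⊤)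
    {Ga : SchemeOver k} [GrpObj Ga] [IsAffine Ga.left] (ιa : Ga ⟶ X) [IsMonHom ιa] [Mono ιa]
    (hGa : ∀ ⦃T : SchemeOver k⦄ (t : T ⟶ X), (∃ s : T ⟶ Ga, s ≫ ιa = t) ↔ ∀ a ∈ 𝔞, t ≫ act a = 1)
    {Gb : SchemeOver k} (ιb : Gb ⟶ X) [Mono ιb]
    (hGb : ∀ ⦃T : SchemeOver k⦄ (t : T ⟶ X), (∃ s : T ⟶ Gb, s ≫ ιb = t) ↔ ∀ b ∈ 𝔟, t ≫ act b = 1)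
    {G : SchemeOver k} [GrpObj G] [IsAffine G.left] [Module.Finite k (Alg G)] (j : G ⟶ X) [IsMonHom j] [Mono j]
    (hG : ∀ ⦃T : SchemeOver k⦄ (t : T ⟶ X), (∃ s : T ⟶ G, s ≫ j = t) ↔ ∀ c ∈ 𝔞 * 𝔟, t ≫ act c = 1) :
    Module.finrank k (Alg G) = Module.finrank k (Alg Ga) * Module.finrank k (Alg Gb) := by
  -- §1 the restricted action on `G` and its laws
  obtain ⟨β, hβm, hβ⟩ := exists_layerEnd_of_idealTorsion act j hG hmul
  haveI := hβm
  have hβ1 : β 1 = 𝟙 G := layerEnd_one j act β hβ hone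
  have hβadd : ∀ a b, β (a + b) = β a * β b := fun a b => layerEnd_add j act β hβ (hadd a b)
  have hβmul : ∀ a b, β (a * b) = β b ≫ β a := fun a b => layerEnd_mul j act β hβ (hmul a b)
  have hk : ∀ c ∈ 𝔞 * 𝔟, β c = 1 := layerEnd_eq_one_of_mem act j hG β hβ
  -- §2 the lifted sub-realisations `Ga ↪ G`, `Gb ↪ G`
  obtain ⟨ι𝔞, hι𝔞⟩ := exists_lift_of_idealTorsion_of_le act j hG ιa hGa Ideal.mul_le_right
  obtain ⟨ι𝔟, hι𝔟⟩ := exists_lift_of_idealTorsion_of_le act j hG ιb hGb Ideal.mul_le_left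
  haveI : Mono ι𝔞 := mono_of_mono_fac hι𝔞
  haveI : Mono ι𝔟 := mono_of_mono_fac hι𝔟
  haveI : IsMonHom ι𝔞 := by
    haveI : IsMonHom (ι𝔞 ≫ j) := by rw [hι𝔞]; infer_instance
    exact isMonHom_of_comp_mono ι𝔞 j
  -- §3 ★ p849988
  exact finrank_alg_eq_mul_of_sup_eq_top β ι𝔞 (exists_comp_lift_eq_iff act j ιa hGa β hβ hι𝔞) ι𝔟
    (exists_comp_lift_eq_iff act j ιb hGb β hβ hι𝔟) hβ1 hβadd hβmul h𝔞𝔟 hk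

/-! ## §4 Dress: an abelian scheme over a field with a ★ `RingAction` -/

/-- **THE RANK OF ANY REALISATION OF `A[𝔞𝔟]` FOR A RING ACTION ON AN ABELIAN SCHEME `A → Spec k`** — §3 with `ι := act.i` (★ `RingAction`: `i_one`, `i_add`, `i_mul`,
homomorphisms): for realisations `Ga ↪ A` of `A[𝔞]` (affine, monomorphic homomorphism), `Gb ↪ A` of `A[𝔟]` (monomorphism) and `𝔞 + 𝔟 = (1)`, every realisation
`G ↪ A` of `A[𝔞𝔟]` (affine, `Γ(G)` finite, monomorphic homomorphism) has `dim_k Γ(G) = dim_k Γ(Ga) · dim_k Γ(Gb)`.  The L2 consumer reads it at the special fibre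
`A_x̄` with `𝔞 := 𝔭_w`, `𝔟 := 𝔭_{c•w}` (`rk = q²·q²`). [cite: Tate1997FiniteFlatGroupSchemes, §(3.7) (p. 146)] [cite: Tate1967, §2.2] [cite: Neukirch1999, Ch. I §3 (3.6)] -/
theorem finrank_alg_eq_mul_of_idealTorsion_realisations_ringAction
    {A : Literature.AlgebraicGeometry.AbelianSchemes.AbelianSchemeOver (Spec (.of k))}
    (ρ : Literature.AlgebraicGeometry.AbelianSchemes.AbelianSchemeOver.RingAction O A)
    {𝔞 𝔟 : Ideal O} (h𝔞𝔟 : 𝔞 ⊔ 𝔟 = ⊤)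
    {Ga : SchemeOver k} [GrpObj Ga] [IsAffine Ga.left] (ιa : Ga ⟶ A.X) [IsMonHom ιa] [Mono ιa]
    (hGa : ∀ ⦃T : SchemeOver k⦄ (t : T ⟶ A.X), (∃ s : T ⟶ Ga, s ≫ ιa = t) ↔ ∀ a ∈ 𝔞, t ≫ ρ.i a = 1)
    {Gb : SchemeOver k} (ιb : Gb ⟶ A.X) [Mono ιb]
    (hGb : ∀ ⦃T : SchemeOver k⦄ (t : T ⟶ A.X), (∃ s : T ⟶ Gb, s ≫ ιb = t) ↔ ∀ b ∈ 𝔟, t ≫ ρ.i b = 1)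
    {G : SchemeOver k} [GrpObj G] [IsAffine G.left] [Module.Finite k (Alg G)] (j : G ⟶ A.X) [IsMonHom j] [Mono j]
    (hG : ∀ ⦃T : SchemeOver k⦄ (t : T ⟶ A.X), (∃ s : T ⟶ G, s ≫ j = t) ↔ ∀ c ∈ 𝔞 * 𝔟, t ≫ ρ.i c = 1) :
    Module.finrank k (Alg G) = Module.finrank k (Alg Ga) * Module.finrank k (Alg Gb) := by
  haveI := ρ.isMonHom
  exact finrank_alg_eq_mul_of_idealTorsion_realisations ρ.i ρ.i_one ρ.i_add ρ.i_mul h𝔞𝔟 ιa hGa ιb hGb j hG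

end IdealTorsionCoprimeSplitting

end Literature.AlgebraicGeometry.GroupSchemes

end
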